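import Mathlib
import Summits.NavierStokesRegularity.NavierStokesRegularity.Theorems.EulerZoomLiouvillePowerGaugeEulerLiouvilleSelfSimilarSwirlRatchet
import Summits.NavierStokesRegularity.NavierStokesRegularity.Theorems.EulerZoomLiouvillePowerGaugeEulerLiouvilleSelfSimilarBernoulliLandscape
import Summits.NavierStokesRegularity.NavierStokesRegularity.Theorems.EulerZoomLiouvillePowerGaugeEulerLiouvilleSelfSimilarRadialBarrierLoc
import HarnessLib

/-!
# Crux E `PowerGaugeEulerLiouville` (stmt-NavierStokesRegularity-19832), THE ONE STATEMENT: THE SWIRL RATCHET, III — THE VOLUME LAW of the swirl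
# distribution of an axisymmetric `C²` self-similar profile; finite-volume swirl support ⇒ swirl-free ⇒ trivial (width seat ns-ezl-w3 g3)

Route №10 `EulerZoomLiouville` (NavierStokesRegularity), crux E; LEAD ns-typeII-p2 g12 («(C2) volume-law widening welcome», 14:29:50Z).  Sequel of
`…SelfSimilarSwirlRatchet` (`SwirlRatchet.fderiv_swirl_transport`: `DΓ[W] = −(1−2γ)Γ`, `Γ = swirl U = rU_θ`).  Along FORWARD similarity orbits the swirl decays,
`Γ(Φ_s y) = e^{−(1−2γ)s}Γ(y)` (`swirl_forward_orbit`), while the similarity flow `Φ_s` of `W = γy + U` EXPANDS Lebesgue measure by `e^{3γs}` (the LEAD's (C1) tool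
`BernoulliLandscape.volume_image_flow_eq_exp_of_stay`, run on the cut-off field of `Loc.exists_cutoff_local_smul`; orbits from a ball stay in a ball by Grönwall under linear
growth, `norm_flow_le_gronwallBound`).  Hence `Φ_s {|Γ| > μ} ⊆ {|Γ| > μe^{−(1−2γ)s}}` has volume `e^{3γs}·vol{|Γ| > μ}`:

* `SwirlRatchet.volume_superlevel_ratchet` — **THE VOLUME LAW (forward half)**: for `μ ∈ ℝ`, `s ≥ 0`,
  `e^{3γs} · vol{y : μ < |Γ y|} ≤ vol{y : μe^{−(1−2γ)s} < |Γ y|}` (any `γ > 0`; `U` axisymmetric `C²` profile of CIV (3.3) of linear growth).  So the swirl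
  distribution function `m(μ) = vol{|Γ| > μ}` of a needle is either `≡ ∞` or obeys `m(μe^{−(1−2γ)s}) ≥ e^{3γs} m(μ)` — in the class (`γ = 1/(2+ρ)`) the exact power law
  `m(μ) ∝ μ^{−3/ρ}` from above.
* `SwirlRatchet.hasNoSwirl_of_finite_swirlSupport` — **FINITE-VOLUME SWIRL SUPPORT ⇒ NO SWIRL** (`γ > 0`): `vol{Γ ≠ 0} < ∞` bounds every `m(μ')`, so
  `m(μ) ≤ vol{Γ ≠ 0}·e^{−3γs} → 0`, the open set `{|Γ| > μ}` is null hence empty, for every `μ > 0`.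
* MEMBER FORM `SwirlRatchet.selfSimilar_ae_eq_zero_of_axisym_finiteSwirlSupport_C2` — crux binders verbatim + exactly self-similar ansatz + `ContDiff ℝ 2 V` + `IsAxisymmetric V` +
  linear growth + `volume {y | swirl V y ≠ 0} < ⊤` ⇒ `u = 0` a.e. (ratchet ⇒ swirl-free ⇒ (S37) `NeedleRace.selfSimilar_ae_eq_zero_of_axisymNoSwirlC2`).

In print: Chae CMP 273 (2007) Thm 2.2 («Note added»: the swirl `rv^θ` as transported scalar) argues with two `L^p` norms of the profile; the distribution-function form
and the finite-support kill are the same scaling idea run set-wise with the tree's localised Liouville formula.  WHAT THIS IS NOT: not NS regularity, not the crux E —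
one more stratum of the crux CLASS 19832 (MODEL lattice; E/NS strata) `--supports` stmt-19832; the swirling axisymmetric `C²` needle with infinite-volume unbounded swirl stays
OPEN.  [cite: Chae2007CMPEuler, Thm 2.2 + Note added p. 6; ConstantinIgnatovaVicol2026Putative, §3.4.1 (3.21)–(3.22)]
-/

noncomputable section

-- flat `Theorems/<Route><Decl>…` files of one crux share the namespace of the crux (tree convention: `Summit.<S>.<S>.…`)
set_option linter.dupNamespace false

open MeasureTheory Set Filter Topology Metric Function InnerProductSpace
open scoped RealInnerProductSpace NNReal ContDiff

namespace Summit.NavierStokesRegularity.NavierStokesRegularity.Theorems.PowerGaugeEulerLiouville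

open Literature.Analysis Literature.Analysis.FluidPDE Literature.Analysis.FunctionSpaces
open Summit.NavierStokesRegularity.NavierStokesRegularity.Theorems.PowerGaugeEulerLiouville.BernoulliLandscape

namespace SwirlRatchet

variable {γ : ℝ} {U V : EuclideanSpace ℝ (Fin 3) → EuclideanSpace ℝ (Fin 3)} {P : EuclideanSpace ℝ (Fin 3) → ℝ}

/-! ### Swirl along forward orbits -/

/-- **SWIRL ALONG A FORWARD ORBIT**: if `Y' = W(Y)` on `[0, s]`, then `Γ(Y s) = Γ(Y 0) · e^{−(1−2γ)s}`. [cite: Chae2007CMPEuler, Thm 2.2 + Note added p. 6] -/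
theorem swirl_forward_orbit (h : IsSelfSimilarEulerProfile γ 0 U P) (hU : IsAxisymmetric U)
    {Y : ℝ → EuclideanSpace ℝ (Fin 3)} {s : ℝ} (hs : 0 ≤ s)
    (hY : ∀ σ ∈ Icc 0 s, HasDerivAt Y (selfSimilarTransport γ 0 U (Y σ)) σ) :
    swirl U (Y s) = swirl U (Y 0) * Real.exp (-((1 - 2 * γ) * s)) := by
  have hd := h.differentiable_velocity
  set f : ℝ → ℝ := fun σ => swirl U (Y σ) * Real.exp ((1 - 2 * γ) * σ) with hf
  have hderΓ : ∀ σ ∈ Icc 0 s, HasDerivAt (fun σ => swirl U (Y σ)) (-((1 - 2 * γ) * swirl U (Y σ))) σ := by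
    intro σ hσ
    have h1 : HasFDerivAt (swirl U) (fderiv ℝ (swirl U) (Y σ)) (Y σ) := (differentiableAt_swirl (hd (Y σ))).hasFDerivAt
    have h2 := h1.comp_hasDerivAt σ (hY σ hσ)
    rw [fderiv_swirl_transport h hU] at h2
    exact h2
  have hderf : ∀ σ ∈ Ico 0 s, HasDerivWithinAt f 0 (Ici σ) σ := by
    intro σ hσ
    have he : HasDerivAt (fun σ => Real.exp ((1 - 2 * γ) * σ)) (Real.exp ((1 - 2 * γ) * σ) * (1 - 2 * γ)) σ := by
      have := ((hasDerivAt_id σ).const_mul (1 - 2 * γ)).exp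
      simp only [mul_one] at this
      exact this
    have hprod := (hderΓ σ (Ico_subset_Icc_self hσ)).mul he
    have h0 : -((1 - 2 * γ) * swirl U (Y σ)) * Real.exp ((1 - 2 * γ) * σ) +
        swirl U (Y σ) * (Real.exp ((1 - 2 * γ) * σ) * (1 - 2 * γ)) = 0 := by ring
    rw [h0] at hprod
    exact hprod.hasDerivWithinAt
  have hcont : ContinuousOn f (Icc 0 s) := fun σ hσ =>
    (((hderΓ σ hσ).continuousAt).mul (Real.continuous_exp.comp (continuous_const.mul continuous_id)).continuousAt).continuousWithinAt
  have hconst := constant_of_has_deriv_right_zero hcont hderf s (right_mem_Icc.2 hs)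
  simp only [hf, mul_zero, Real.exp_zero, mul_one] at hconst
  have hexp : Real.exp ((1 - 2 * γ) * s) * Real.exp (-((1 - 2 * γ) * s)) = 1 := by
    rw [← Real.exp_add, add_neg_cancel, Real.exp_zero]
  calc swirl U (Y s) = swirl U (Y s) * (Real.exp ((1 - 2 * γ) * s) * Real.exp (-((1 - 2 * γ) * s))) := by rw [hexp, mul_one]
    _ = swirl U (Y 0) * Real.exp (-((1 - 2 * γ) * s)) := by rw [← mul_assoc, hconst]

/-! ### Orbits from a ball stay in a ball (linear growth, Grönwall) -/

/-- `gronwallBound` is monotone in the initial size and in time (`K > 0`, `ε ≥ 0`, `0 ≤ δ ≤ δ'`, `0 ≤ x ≤ x'`). [folklore] -/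
theorem gronwallBound_mono {δ δ' K ε x x' : ℝ} (hK : 0 < K) (hε : 0 ≤ ε) (hδ : 0 ≤ δ) (hδδ' : δ ≤ δ') (hx : x ≤ x') :
    gronwallBound δ K ε x ≤ gronwallBound δ' K ε x' := by
  rw [gronwallBound_of_K_ne_0 hK.ne', gronwallBound_of_K_ne_0 hK.ne']
  have h1 : Real.exp (K * x) ≤ Real.exp (K * x') := Real.exp_le_exp.2 (mul_le_mul_of_nonneg_left hx hK.le)
  have h2 : 0 ≤ ε / K := div_nonneg hε hK.le
  have h3 : 0 ≤ Real.exp (K * x') := (Real.exp_pos _).le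
  nlinarith [mul_le_mul_of_nonneg_left h1 hδ, mul_le_mul_of_nonneg_left h1 h2, mul_le_mul_of_nonneg_right hδδ' h3]

/-- **Orbits of the similarity flow of a field of linear growth grow at most like Grönwall's bound**: `V ∈ C¹`, `‖DV‖ ≤ K`, `‖V y‖ ≤ K₁(1+‖y‖)`, `γ ≥ 0` ⇒
`‖Φ_σ y‖ ≤ gronwallBound ‖y‖ (γ+K₁) K₁ σ` for `σ ≥ 0`. [folklore] -/
theorem norm_flow_le_gronwallBound (hV1 : ContDiff ℝ 1 V) {K : ℝ} (hK : ∀ y, ‖fderiv ℝ V y‖ ≤ K)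
    {K₁ : ℝ} (hlin : ∀ y, ‖V y‖ ≤ K₁ * (1 + ‖y‖)) (hγ : 0 ≤ γ) (y : EuclideanSpace ℝ (Fin 3)) {σ : ℝ} (hσ : 0 ≤ σ) :
    ‖ODE.evolutionMap (fun _ : ℝ => selfSimilarTransport γ 0 V) 0 σ y‖ ≤ gronwallBound ‖y‖ (γ + K₁) K₁ σ := by
  set f : ℝ → EuclideanSpace ℝ (Fin 3) := fun r => ODE.evolutionMap (fun _ : ℝ => selfSimilarTransport γ 0 V) 0 r y with hf
  have hder : ∀ r, HasDerivAt f (selfSimilarTransport γ 0 V (f r)) r := fun r => C2.Kelvin.hasDerivAt_flow (γ := γ) hV1 hK r y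
  have hcont : ContinuousOn f (Icc 0 σ) := fun r _ => (hder r).continuousAt.continuousWithinAt
  have hf0 : ‖f 0‖ ≤ ‖y‖ := by simp [hf, ODE.evolutionMap_self]
  have hbound : ∀ r ∈ Ico 0 σ, ‖selfSimilarTransport γ 0 V (f r)‖ ≤ (γ + K₁) * ‖f r‖ + K₁ := by
    intro r _
    rw [selfSimilarTransport_apply, sub_zero]
    calc ‖γ • f r + V (f r)‖ ≤ ‖γ • f r‖ + ‖V (f r)‖ := norm_add_le _ _
      _ ≤ γ * ‖f r‖ + K₁ * (1 + ‖f r‖) := by rw [norm_smul, Real.norm_of_nonneg hγ]; exact add_le_add le_rfl (hlin _)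
      _ = (γ + K₁) * ‖f r‖ + K₁ := by ring
  have h := norm_le_gronwallBound_of_norm_deriv_right_le hcont (fun r _ => (hder r).hasDerivWithinAt) hf0 hbound σ
    (right_mem_Icc.2 hσ)
  rwa [sub_zero] at h

/-! ### The volume law -/

/-- **THE VOLUME LAW OF THE SWIRL DISTRIBUTION (forward half).**  `(U, P)` a `C²` self-similar Euler profile (CIV (3.3)), `γ > 0`, `U` axisymmetric of linear growth
`‖U y‖ ≤ K₁(1+‖y‖)`, `Γ = swirl U`.  For every level `μ` and every `s ≥ 0`:
`e^{3γs} · vol{y | μ < |Γ y|} ≤ vol{y | μe^{−(1−2γ)s} < |Γ y|}`.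
(The similarity flow — run on a cut-off field equal to `U` on a ball containing all orbits from `{|Γ|>μ} ∩ B_n` up to time `s` — maps `{|Γ|>μ} ∩ B_n` into
`{|Γ| > μe^{−(1−2γ)s}}` by the forward ratchet and multiplies its volume by `e^{3γs}`; let `n → ∞`.) [cite: Chae2007CMPEuler, Thm 2.2 + Note added p. 6] -/
theorem volume_superlevel_ratchet (h : IsSelfSimilarEulerProfile γ 0 U P) (hU : IsAxisymmetric U) (hγ : 0 < γ)
    {K₁ : ℝ} (hlin : ∀ y, ‖U y‖ ≤ K₁ * (1 + ‖y‖)) (μ : ℝ) {s : ℝ} (hs : 0 ≤ s) :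
    ENNReal.ofReal (Real.exp (3 * γ * s)) * volume {y : EuclideanSpace ℝ (Fin 3) | μ < |swirl U y|} ≤
      volume {y : EuclideanSpace ℝ (Fin 3) | μ * Real.exp (-((1 - 2 * γ) * s)) < |swirl U y|} := by
  have hK₁ : 0 ≤ K₁ := by
    have h0 := hlin 0
    rw [norm_zero, add_zero, mul_one] at h0
    exact (norm_nonneg _).trans h0
  have hΓc : Continuous (swirl U) := (contDiff_swirl h.contDiff_velocity).continuous
  set S : Set (EuclideanSpace ℝ (Fin 3)) := {y | μ < |swirl U y|} with hS
  set S' : Set (EuclideanSpace ℝ (Fin 3)) := {y | μ * Real.exp (-((1 - 2 * γ) * s)) < |swirl U y|} with hS'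
  have hSo : IsOpen S := isOpen_lt continuous_const (continuous_abs.comp hΓc)
  -- exhaust `S` by balls
  have hmono : Monotone fun n : ℕ => S ∩ ball (0 : EuclideanSpace ℝ (Fin 3)) n :=
    fun a b hab => inter_subset_inter_right _ (ball_subset_ball (by exact_mod_cast hab))
  have hUnion : (⋃ n : ℕ, S ∩ ball (0 : EuclideanSpace ℝ (Fin 3)) n) = S := by
    ext y
    simp only [mem_iUnion, mem_inter_iff, mem_ball_zero_iff]
    constructor
    · rintro ⟨n, hy, -⟩; exact hy
    · intro hy; obtain ⟨n, hn⟩ := exists_nat_gt ‖y‖; exact ⟨n, hy, hn⟩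
  have hsup : volume S = ⨆ n : ℕ, volume (S ∩ ball (0 : EuclideanSpace ℝ (Fin 3)) n) := by
    rw [← hmono.measure_iUnion, hUnion]
  rw [hsup, ENNReal.mul_iSup]
  refine iSup_le fun n => ?_
  -- ### one ball: `A = S ∩ B_n`
  set A : Set (EuclideanSpace ℝ (Fin 3)) := S ∩ ball (0 : EuclideanSpace ℝ (Fin 3)) n with hA
  have hAm : MeasurableSet A := hSo.measurableSet.inter measurableSet_ball
  -- the radius swept by the orbits from `B_n` up to time `s`, and the cut-off field
  set L : ℝ := γ + K₁ with hL
  have hL0 : 0 < L := by rw [hL]; linarith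
  set Rstar : ℝ := gronwallBound (n : ℝ) L K₁ s with hRstar
  have hRstar0 : 0 ≤ Rstar := by
    rw [hRstar, gronwallBound_of_K_ne_0 hL0.ne']
    have h1 : 1 ≤ Real.exp (L * s) := Real.one_le_exp (by positivity)
    have h2 : 0 ≤ K₁ / L := div_nonneg hK₁ hL0.le
    positivity
  set Rbig : ℝ := Rstar + 2 with hRbig
  have hRbig0 : 0 < Rbig := by rw [hRbig]; linarith
  obtain ⟨V, hV2, -, hsmul, ⟨K, hK⟩, hVU⟩ := Loc.exists_cutoff_local_smul h.contDiff_velocity hRbig0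
  have hV1 : ContDiff ℝ 1 V := hV2.of_le (by norm_num)
  have hVlin : ∀ y, ‖V y‖ ≤ K₁ * (1 + ‖y‖) := by
    intro y
    obtain ⟨c, hc0, hc1, hcy⟩ := hsmul y
    rw [hcy, norm_smul, Real.norm_of_nonneg hc0]
    exact (mul_le_of_le_one_left (norm_nonneg _) hc1).trans (hlin y)
  set Φ : ℝ → EuclideanSpace ℝ (Fin 3) → EuclideanSpace ℝ (Fin 3) :=
    ODE.evolutionMap (fun _ : ℝ => selfSimilarTransport γ 0 V) 0 with hΦ
  have hWU : ∀ z : EuclideanSpace ℝ (Fin 3), ‖z‖ < Rbig → selfSimilarTransport γ 0 V z = selfSimilarTransport γ 0 U z := by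
    intro z hz
    simp only [selfSimilarTransport_apply, hVU z (mem_ball_zero_iff.2 hz)]
  -- orbits from `A` stay in the ball `‖z‖ ≤ Rstar` on `[0, s]`
  have hstay : ∀ y ∈ A, ∀ σ ∈ Icc 0 s, ‖Φ σ y‖ ≤ Rstar := by
    intro y hy σ hσ
    have hyn : ‖y‖ ≤ n := (mem_ball_zero_iff.1 hy.2).le
    exact (norm_flow_le_gronwallBound (γ := γ) hV1 hK hVlin hγ.le y hσ.1).trans
      (gronwallBound_mono hL0 hK₁ (norm_nonneg _) hyn hσ.2)
  -- the cut-off field is divergence-free on the bigger ball `‖z‖ ≤ Rstar + 1`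
  have hdiv : ∀ z : EuclideanSpace ℝ (Fin 3), ‖z‖ ≤ Rstar + 1 → VectorCalculus.divergence V z = 0 := by
    intro z hz
    have hzball : z ∈ ball (0 : EuclideanSpace ℝ (Fin 3)) Rbig := mem_ball_zero_iff.2 (by rw [hRbig]; linarith)
    have hev : V =ᶠ[𝓝 z] U := by
      filter_upwards [isOpen_ball.mem_nhds hzball] with w hw using hVU w hw
    unfold VectorCalculus.divergence
    rw [hev.fderiv_eq]
    exact h.divFree z
  -- the volume law for the cut-off flow
  have hvol : volume (Φ s '' A) = ENNReal.ofReal (Real.exp (3 * γ * s)) * volume A :=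
    volume_image_flow_eq_exp_of_stay (γ := γ) hV2 hK hs hdiv hAm
      (fun y hy σ hσ => (hstay y hy σ hσ).trans (by linarith))
  -- the image sits in `S'` (forward ratchet along the true orbit)
  have himage : Φ s '' A ⊆ S' := by
    rintro _ ⟨y, hy, rfl⟩
    set Y : ℝ → EuclideanSpace ℝ (Fin 3) := fun σ => Φ σ y with hYdef
    have hY0 : Y 0 = y := by simp [hYdef, hΦ, ODE.evolutionMap_self]
    have hYU : ∀ σ ∈ Icc 0 s, HasDerivAt Y (selfSimilarTransport γ 0 U (Y σ)) σ := by
      intro σ hσ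
      have h1 := C2.Kelvin.hasDerivAt_flow (γ := γ) hV1 hK σ y
      rw [hWU _ (lt_of_le_of_lt (hstay y hy σ hσ) (by rw [hRbig]; linarith))] at h1
      exact h1
    have hrat := swirl_forward_orbit h hU hs hYU
    rw [hY0] at hrat
    show μ * Real.exp (-((1 - 2 * γ) * s)) < |swirl U (Y s)|
    rw [hrat, abs_mul, abs_of_pos (Real.exp_pos _)]
    exact mul_lt_mul_of_pos_right hy.1 (Real.exp_pos _)
  calc ENNReal.ofReal (Real.exp (3 * γ * s)) * volume A = volume (Φ s '' A) := hvol.symm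
    _ ≤ volume S' := measure_mono himage

/-! ### Finite-volume swirl support ⇒ no swirl -/

/-- **FINITE-VOLUME SWIRL SUPPORT ⇒ NO SWIRL** (`γ > 0`).  `(U, P)` a `C²` self-similar Euler profile, `U` axisymmetric of linear growth, and `vol{y | Γ y ≠ 0} < ∞` for
`Γ = swirl U`.  Then `Γ ≡ 0`: by the volume law `e^{3γs}·vol{|Γ| > μ} ≤ vol{Γ ≠ 0}` for every `s ≥ 0`, so the OPEN set `{|Γ| > μ}` is null, hence empty, for every
`μ > 0`. [cite: Chae2007CMPEuler, Thm 2.2 + Note added p. 6] -/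
theorem hasNoSwirl_of_finite_swirlSupport (h : IsSelfSimilarEulerProfile γ 0 U P) (hU : IsAxisymmetric U) (hγ : 0 < γ)
    {K₁ : ℝ} (hlin : ∀ y, ‖U y‖ ≤ K₁ * (1 + ‖y‖))
    (hfin : volume {y : EuclideanSpace ℝ (Fin 3) | swirl U y ≠ 0} < ⊤) : HasNoSwirl U := by
  have hΓc : Continuous (swirl U) := (contDiff_swirl h.contDiff_velocity).continuous
  set M : ENNReal := volume {y : EuclideanSpace ℝ (Fin 3) | swirl U y ≠ 0} with hM
  -- every positive superlevel set is null
  have hnull : ∀ μ : ℝ, 0 < μ → volume {y : EuclideanSpace ℝ (Fin 3) | μ < |swirl U y|} = 0 := by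
    intro μ hμ
    set v : ENNReal := volume {y : EuclideanSpace ℝ (Fin 3) | μ < |swirl U y|} with hv
    have hsub : ∀ s : ℝ, {y : EuclideanSpace ℝ (Fin 3) | μ * Real.exp (-((1 - 2 * γ) * s)) < |swirl U y|} ⊆
        {y | swirl U y ≠ 0} := by
      intro s y hy
      have h1 : 0 < |swirl U y| := lt_of_le_of_lt (by positivity) hy
      exact abs_pos.1 h1
    have hbound : ∀ s : ℝ, 0 ≤ s → ENNReal.ofReal (Real.exp (3 * γ * s)) * v ≤ M :=
      fun s hs => (volume_superlevel_ratchet h hU hγ hlin μ hs).trans (measure_mono (hsub s))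
    have hvM : v ≤ M := by simpa using hbound 0 le_rfl
    have hvtop : v ≠ ⊤ := ne_top_of_le_ne_top hfin.ne hvM
    by_contra hv0
    have hvpos : 0 < v.toReal := ENNReal.toReal_pos hv0 hvtop
    -- choose `s` with `e^{3γs} v > M`
    set s : ℝ := (M.toReal / v.toReal + 1) / (3 * γ) with hsdef
    have hs0 : 0 ≤ s := by rw [hsdef]; positivity
    have hexp : M.toReal / v.toReal + 1 < Real.exp (3 * γ * s) := by
      have h1 : 3 * γ * s = M.toReal / v.toReal + 1 := by rw [hsdef]; field_simp
      rw [h1]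
      linarith [Real.add_one_le_exp (M.toReal / v.toReal + 1)]
    have h2 : M.toReal < Real.exp (3 * γ * s) * v.toReal := by
      have h3 : M.toReal < (M.toReal / v.toReal + 1) * v.toReal := by
        rw [add_mul, div_mul_cancel₀ _ hvpos.ne', one_mul]; linarith
      exact h3.trans (mul_lt_mul_of_pos_right hexp hvpos)
    have h4 := hbound s hs0
    have h5 : (ENNReal.ofReal (Real.exp (3 * γ * s)) * v).toReal ≤ M.toReal := ENNReal.toReal_mono hfin.ne h4
    rw [ENNReal.toReal_mul, ENNReal.toReal_ofReal (Real.exp_pos _).le] at h5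
    linarith
  -- null open sets are empty
  intro y
  by_contra hne
  have hμ : 0 < |swirl U y| / 2 := by positivity
  have hopen : IsOpen {z : EuclideanSpace ℝ (Fin 3) | |swirl U y| / 2 < |swirl U z|} :=
    isOpen_lt continuous_const (continuous_abs.comp hΓc)
  have hempty := (hopen.measure_eq_zero_iff volume).1 (hnull _ hμ)
  have hy : y ∈ {z : EuclideanSpace ℝ (Fin 3) | |swirl U y| / 2 < |swirl U z|} := by
    show |swirl U y| / 2 < |swirl U y|
    linarith [abs_pos.2 hne]
  rw [hempty] at hy
  exact hy

end SwirlRatchet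

/-! ### Member form -/

namespace SwirlRatchet

variable {u : ℝ → EuclideanSpace ℝ (Fin 3) → EuclideanSpace ℝ (Fin 3)} {p : ℝ → EuclideanSpace ℝ (Fin 3) → ℝ}
  {H : ℝ → EuclideanSpace ℝ (Fin 3) → EuclideanSpace ℝ (Fin 3) →L[ℝ] EuclideanSpace ℝ (Fin 3)} {c : ℝ≥0}
  {V : EuclideanSpace ℝ (Fin 3) → EuclideanSpace ℝ (Fin 3)} {P : EuclideanSpace ℝ (Fin 3) → ℝ}

/-- **MEMBER FORM: AXISYMMETRIC `C²` PROFILE OF LINEAR GROWTH WHOSE SWIRL HAS FINITE-VOLUME SUPPORT ⇒ TRIVIAL.**  Crux binders verbatim (`0 < ρ ≤ ½`) + exactly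
self-similar ansatz about the origin + `ContDiff ℝ 2 V` + `IsAxisymmetric V` + `‖V y‖ ≤ K₁(1+‖y‖)` + `volume {y | swirl V y ≠ 0} < ⊤` ⇒ `u = 0` a.e.
(volume law ⇒ swirl-free ⇒ (S37)). [cite: Chae2007CMPEuler, Thm 2.2 + Note added p. 6] -/
theorem selfSimilar_ae_eq_zero_of_axisym_finiteSwirlSupport_C2 {ρ : ℝ} (hρ : 0 < ρ) (hρ1 : ρ ≤ 1 / 2)
    (hsw : IsSuitableWeakSolutionOn (slab (EuclideanSpace ℝ (Fin 3)) (Iio 0) isOpen_Iio) 0 0 u p)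
    (hH : HasWeakSpatialGradientOn (slab (EuclideanSpace ℝ (Fin 3)) (Iio 0) isOpen_Iio) u H)
    (hgauge : ∀ a : ℝ, 0 < a →
      ENNReal.ofReal (a ^ (2 * ρ)) * cknA a (0 : ℝ × EuclideanSpace ℝ (Fin 3)) u +
          ENNReal.ofReal (a ^ ρ) * cknE a (0 : ℝ × EuclideanSpace ℝ (Fin 3)) H +
        ENNReal.ofReal (a ^ (2 * ρ)) * cknD a (0 : ℝ × EuclideanSpace ℝ (Fin 3)) p ≤ (c : ENNReal))
    (hu : ∀ τ : ℝ, τ < 0 → u τ = selfSimilarCollapse (1 / (2 + ρ)) 0 V τ)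
    (hp : ∀ τ : ℝ, τ < 0 → p τ = selfSimilarCollapsePressure (1 / (2 + ρ)) 0 P τ)
    (hV : ContDiff ℝ 2 V) (hax : IsAxisymmetric V)
    (hlin : ∃ K₁ : ℝ, ∀ y, ‖V y‖ ≤ K₁ * (1 + ‖y‖))
    (hfin : volume {y : EuclideanSpace ℝ (Fin 3) | swirl V y ≠ 0} < ⊤) :
    uncurry u =ᵐ[volume.restrict (Iio (0 : ℝ) ×ˢ (univ : Set (EuclideanSpace ℝ (Fin 3))))] 0 := by
  obtain ⟨K₁, hK₁⟩ := hlin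
  have hρ1' : ρ < 1 := by linarith
  have h2ρ : (0 : ℝ) < 2 + ρ := by linarith
  have hγ : (0 : ℝ) < 1 / (2 + ρ) := one_div_pos.2 h2ρ
  -- a classical pressure of the profile (boilerplate of the lineage's member theorems)
  have hD : ∀ a : ℝ, 0 < a → ENNReal.ofReal (a ^ (2 * ρ)) *
      cknD a (0 : ℝ × EuclideanSpace ℝ (Fin 3)) p ≤ (c : ENNReal) :=
    fun a ha => le_trans le_add_self (hgauge a ha)
  have hpm : AEStronglyMeasurable (uncurry p)
      (volume.restrict (Iio (0 : ℝ) ×ˢ (univ : Set (EuclideanSpace ℝ (Fin 3))))) := by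
    have := hsw.distributional.2.2.1.aestronglyMeasurable
    simpa [slab] using this
  have hPm := aestronglyMeasurable_pressureProfile hpm hp
  have hDprof := profile_pressure_weight_of_gaugeD hρ hρ1' hpm hp hD
  have hP1 : LocallyIntegrable P volume :=
    EnergySaturation.locallyIntegrable_pressure_of_weight hρ1' hPm
      (ENNReal.mul_ne_top ENNReal.ofReal_ne_top ENNReal.coe_ne_top) hDprof
  obtain ⟨P', hprof⟩ := WeakToClassical.exists_isSelfSimilarEulerProfile_of_contDiff hsw.distributional hu hp hV hP1
  have hns : HasNoSwirl V := hasNoSwirl_of_finite_swirlSupport hprof hax hγ hK₁ hfin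
  exact NeedleRace.selfSimilar_ae_eq_zero_of_axisymNoSwirlC2 hρ hρ1 hsw hH hgauge hu hp hV hax hns

end SwirlRatchet

end Summit.NavierStokesRegularity.NavierStokesRegularity.Theorems.PowerGaugeEulerLiouville

end
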